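import Summits.BirchSwinnertonDyer.Rank1Residual.X11b.KolyvaginSqueezeRecordsKitThree
import HarnessLib

/-!
# BSD rank-≤1 residual cell, rank ONE at `p = 3` with `#Ш_an = 9` (cells (3,'X11b') / (3,'X4') / (3,'X7') /
(3,'X8')): `BSD(E,3)` PER PAIR by the
# Kolyvagin SQUEEZE — Heegner-index certificate `ord₃ [E(K):ℤy_K] = 1` (upper half, two engines) × two-engine EXACT
`3`-descent `dim Sel³(E/ℚ) = 3`
# (lower half, Cassels–Tate) — records 04 of 11 (unit `b2b-bsdres-x11c` GEN 38 «KOLY3-SQUEEZE»,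
prover-b2b-bsdres-x11c-g38-0, 2026-08-28)

HONEST FRAMING (cell `b2b-bsdres-*`, verbatim): prove what is provable now; shrink each hard class to its core with
data; no claim beyond
stated classes; COMBINATION classes deleted from PUBLISHED theorems only, CONSTRUCTION-shaped remainder typed; this
is not "finishing BSD".
X11b (and X11 ∧ r = 1 ∧ p = 3, R6.2), X4, X7, X8 stay CONSTRUCTION-SHAPED as classes; PER PAIR; nothing booked by
this file (referee A
books); NO named fact introduced; NO definition; class labels of other cells' classes (X4: n1011 / additive-p*,
X7/X8: x10b /
additive-p3 / bsd-ssimc) are untouched — these are SERVICE records on their cells, nothing of theirs superseded.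

WHAT. On referee A2's state `pub-bsdpct-r5-g15/scratchA2_state_after_kurx4am_add1c5_onA2R1030_fold.pkl`
(45ab5fdd2800f5ab) there
are 77 rank-ONE residue classes with an open cell `(3, X)`, `X ∈ {X11b, X4, X7, X8}`, whose curve `…1` has
`#Ш_an = 9`, `ρ̄_{E,3}`
onto (no Cremona galrep 3-code) and `3 ∤ #E(ℚ)_tors·∏c_ℓ` (population
`HOME/b2b-bsdres-x11c/gen38/squeeze/pop/pop38b.json`). On such
a cell neither a Kolyvagin `3 ∤ [E(K):ℤy_K]` certificate (GEN 35 KOLY3) nor a `dim Sel³ = rank` certificate (T-SEL3)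
can exist: BSD
predicts `Ш(E)[3^∞] ≅ (ℤ/3)²`. THE SQUEEZE (unit `b2b-bsdres-sha-2`'s
`Rank1Residual.bsdp_of_kolyvagin_index_of_casselsTate_of_pow_dvd`,
`X4/KolyvaginSqueeze.lean`; ANY odd `p`, analytic rank `≤ 1`, NO hypothesis on the reduction of `E` at `p`): UPPER
half
`ord₃ #Ш(E/ℚ) ≤ 2` from Kolyvagin as printed by McCallum 1991 §1 (`ord₃ #Ш(E/K) ≤ 2·ord₃ [E(K):ℤy_K]`, named facts
`kolyvagin`,
`Kolyvagin1990_padicValNat_card_sha_le`, registry A20, referee C2 ROUND 326 «p = 3 allowed as printed») with the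
odd-part splitting
`#Ш(E/K)[3^∞] = #Ш(E/ℚ)[3^∞]·#Ш(E^{(d_K)}/ℚ)[3^∞]` (JSW 2017 §7.4.1, tree theorem) and the certificate
`ord₃ [E(K):ℤy_K] ≤ 1`;
LOWER half `9 ∣ #Ш(E/ℚ)` from ONE descent line `#Sel^(3)(E/ℚ) = 27` (`rank = r_an = 1` by GZK, `3 ∤ #E(ℚ)_tors` by the
irreducibility of `E[3]` ⇒ `Ш(E)[3] ≠ 0`, `Typed.exists_sha_torsion_of_pow_rank_lt_card_selmerGroup`) and
Cassels–Tate squareness;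
with `#Ш_an = 9`: Miller's `BSD(E,3)`. KERNEL (per pair, through the unit's GEN 38 kit
`X11b.bsdp_three_of_kolyvaginIndexLeOne_of_card_selmer_of_irr_of_order`,
`X11b/KolyvaginSqueezeRecordsKitThree.lean`, every numeric
hypothesis a `decide` / `norm_num` goal): global minimality of Cremona's model by prover B's factored Kraus
criterion on the COMPLETE
factorisation of `|Δ|`; `ρ̄_{E,3}` ONTO from two Frobenius witnesses (Serre 1972 Prop. 15: an irreducible Frobenius
and one of order 3,
schema point counts). DISPLAYED binders per record (evidence, certified outside Lean — exactly the KOLY3 tuple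
referee A booked flag-free
at R958 / R961, plus `hCT`, the twist datum and `hSel`): `hGZK`, `hCT`, `hKo`, `hB`; the Heegner datum `K = ℚ(√D)`
(`hK`, `hH`),
`P = y_K` (`hP`, `hnt`) with `hI : ord₃ [E(K):ℤP] ≤ 1`; the twist datum `Wd` = Cremona's / PARI's minimal model of
`E^{(D)}` with
`hWd` (a `ℚ`-isomorphism class statement) and `hrD : r_an(Wd) ≤ 1` (the engines: root number `+1`, `L(E^D,1) ≠ 0`);
`hr : r_an = 1`,
`hq`/`hv : #Ш_an = 9` (Cremona); `hSel : #Sel^(3)(E/ℚ) = 3^3`.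
ENGINES (all BYTE-IDENTICAL, sha256 in each run folder's `outputs/inputs.sha256`; run folders
`HOME/b2b-bsdres-x11c/gen38/squeeze/harvest/<job>/`
with the daemon's `MANIFEST.json`): Heegner index — ENGINE 1 = the unit's gen-3 `main.py` (sha256 `69e29ec7…` = X9
g7 `jobD1b.py`;
PARI `ellL1`, `ellheight`, period lattice; `m² = 4·ĥ(y_K)/ĥ(x)` with `x` Cremona's generator saturated; kit j303974,
NDISC 12 /
DBOUND 6000: per pair the FIRST Heegner field `K = ℚ(√D)` (every `q ∣ N` split, `3 ∤ D`) with `ord₃ m = 1` is the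
certificate
field; earlier fields with `ord₃ m ≥ 2` are listed per row) ‖ ENGINE 2 = `run_cert.py` (sha256 `1b54bb20…`, stdlib
only, X9 gen 7:
recomputes `a_ℓ`, `L'(E,1)`, `L(E^D,1)`, the period lattice, `ĥ(x)` by Tate's series, `ĥ(y_K)` by
Gross–Zagier–Zhang, `m`,
`ord₃ m` — EQUAL —, plus a `3`-saturation witness prime for `x` and an `E(K)[3] = 0` witness prime; kit j304100) ‖
STAGE C =
additive-p1's `twistvals` (sha256 `e501b988…`; kit j304101): `N_{E^D}`, root number, `L(E^D,1)`, `Ω`, `#tors`, `∏c`,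
`#Ш_an(E^D)`
(BSD-consistency of the twist side: `3 ∤ #tors(E^D)·#Ш_an(E^D)`, as the squeeze predicts `Ш(E^D)[3] = 0`). Descent —
ENGINE C =
unit `b2b-bsdres-x11b`'s `desc3lib.gp` (sha256 `c4fb20b7…`, exact-element Schaefer–Stoll, one orbit = surjective
image; kit j305968) ‖
ENGINE E = unit `b2b-bsdres-x10b`'s INDEPENDENT `desc3full_e2.py` (sha256 `dfa51aff…`; kit j305969): per row the
descent grade EE / EL / LE / LL
(E = `EXACT(bnfcertify1+3sat)` equality, L = three independent EXACTLY verified Selmer elements = the unconditional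
lower bound `dim ≥ 3`,
equality modulo the class group); every row `dim Sel^(3)(E/ℚ) ≥ 3` on BOTH engines (expected `= rank + 2`),
Cremona's generator located in
the Selmer group; the kit consumes only `3³ ≤ #Sel^(3)(E/ℚ)` (`…_of_le_card_selmer_…`, the kit file's second
theorem). Tables:
`HOME/b2b-bsdres-x11c/gen38/squeeze/harvest/rows38b.json`, `gen38/squeeze/ROWS38B-TABLE.md`. THIS FILE (records 04):
7 pairs — `454890d1` (X11b), `460023a1` (X11b), `463926a1` (X11b), `466350e1` (X11b), `468438b1` (X11b), `468519c1`
(X11b), `471417f1` (X11b).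

References: McCallum 1991 §1 [McCallumLMS1991]; Gross 1991 [GrossLMS1991]; Kolyvagin 1990
[KolyvaginEulerSystems1990]; Gross–Zagier
1986 [GrossZagier1986]; Jetchev–Skinner–Wan 2017 §7.4 [JetchevSkinnerWan2017]; Serre 1972 §2.4 Prop. 15 [Serre1972];
Silverman AEC
X.4.2, X.4.14, VII.3.1 [SilvermanAEC2009]; Kraus 1989 [Kraus1989]; Schaefer–Stoll 2004 [SchaeferStoll2004]; Miller
2011 Def. 1.1, Thm.
4.1 [Miller2011LMS]; Cremona's tables [Cremona2006].
-/

set_option autoImplicit false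

noncomputable section

open scoped Classical

open WeierstrassCurve Literature.NumberTheory.EllipticCurves
  Literature.NumberTheory.EllipticCurves.Rank1Residual
  Literature.NumberTheory.EllipticCurves.Rank1Residual.Typed
  Literature.NumberTheory.EllipticCurves.Rank1Residual.X11RankOneCertificates
  Summit.BirchSwinnertonDyer.BirchSwinnertonDyer.Rank1Residual.IntModel
  Summit.BirchSwinnertonDyer.BirchSwinnertonDyer.Rank1Residual.X11RankOne

namespace Summit.BirchSwinnertonDyer.Rank1Residual.X11b

/-- **`BSD(E,3)` for `454890d1`** (`N = 454890 = 2·3·5·59·257`; `3 ∥ N`, non-split multiplicative at `3`, `E[3]` irreducible (class X11b); `#tors = 1`,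
`∏c = 4` (`3 ∤ #tors·∏c`), `r_an = 1`, **`#Ш_an = 9`**, galrep none (no 3-code: `ρ̄_{E,3}` onto), generator Cremona's (11-digit numerator); residue
class of A2 state `45ab5fdd`, (3,'X11b') the SOLE open cell). HEEGNER INDEX (upper half): fields with `ord₃ m ≥ 2` before the certificate field:
none. `D = -719` (719 prime; every prime of `N` split, `3 ∤ D`): **`m = 192`, `ord₃ m = 1`** (`ρ = ĥ(y_K)/ĥ(x) = 9216.00…`; `L′(E,1) = 5.47976905…`,
`L(E^D,1) = 0.66799146…`, `ĥ(x) = 12.67907425…`) — engine 1 (j303974) = engine 2 (j304100; EQUAL `m = 192`, `ord₃ m = 1`, dev. ≤ 4.6e-14, checks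
true; `3`-saturation witness prime [13, 21], `E(K)[3] = 0` witness prime [7, 'split', 4]); twist `E^D` (stage C j304101): minimal model
`[1, 1, 0, -787582439466943, 9310824584903300931013]`, `N_{E^D} = 235160389290`, root number `+1`, `L(E^D,1) = 0.66799146… ≠ 0` ⇒ `r_an(E^D) = 0`;
`#tors = 1`, `∏c = 8`, `#Ш_an(E^D) = 64` — `3 ∤ #tors·#Ш_an(E^D)` (BSD-shape: the squeeze forces `Ш(E^D)[3] = 0`). DESCENT (lower half): engine C
x11b `desc3lib` (j305968): octic `A` disc `-93642789394485292658670000`, `S = [2, 3, 5, 7, 11, 13, 59, 257]`, `Cl(A) = [18, [6, 3]]`,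
`bnfcertify(A,1) = 1`, `29` generators 3-saturated, `dim H¹(ℚ,E[3];S) = 7`, **`dim Sel^(3)(E/ℚ) = 3`** (expected 3: MATCH), generator in `Sel`, mode
`GRH(3sat)`, cert `certs/cert_454890d1.gp` `cb7d24cb37e369ef…`; engine E x10b `desc3full_e2` (j305969): `Cl = [18, [6, 3]]`, `Cl_S = [1, []]`, `29`
generators, `bnfcertify = -2`, `dim H¹ = 7`, **`dim Sel^(3)(E/ℚ) = 3`**, mode `LOWERBOUND` — TWO independent implementations, descent grade **LL**
(E = equality EXACT, L = three independent EXACTLY verified Selmer elements = the unconditional LOWER bound `dim ≥ 3`; the kit uses only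
`3³ ≤ #Sel`) ⇒ `27 ≤ #Sel^(3)(E/ℚ)`, `Ш(E)[3] ≠ 0` — the lower half. Witnesses mod `3` `(ℓ,#Ẽ(𝔽_ℓ))` = `(37,38)` (`a = 0`: `X² − aX + ℓ` root-free
over `𝔽₃`), `(13,21)` (`ℓ ≡ 1`, `a = -7 ≡ 2 (mod 3)`, `9 ∤ #Ẽ`). `|Δ| = ∏` over `[(2, 19), (3, 10), (5, 20), (59, 1), (257, 1)]`. Kernel:
minimality, onto, `3 ∣ #Ш` from `hSel`; displayed: `hGZK hCT hKo hB`, Heegner datum (`hK hH hP hnt hI`), twist datum (`Wd hWd hrD`), `hr hq hv`,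
`hSel : 3³ ≤ #Sel^(3)(E/ℚ)`.
[cite: McCallumLMS1991, §1 Theorem (Kolyvagin), p. 296] [cite: SilvermanAEC2009, Thm. X.4.2(a) and Thm. X.4.14] [cite: Serre1972, §2.4 Prop. 15] [cite: Cremona2006, Table 1 (label 454890d1)] -/
theorem bsdp_q454890d1_3 (hGZK : rank_eq_analyticRank_of_analyticRank_le_one)
    (hCT : exists_casselsTate_pairing (K := ℚ)) (W : WeierstrassCurve ℚ)
    (hW : W = ⟨1, 1, 0, -1523485213, -25050274786307⟩) {N : ℕ} [NeZero N] {K : Type} [Field K] [NumberField K]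
    (hKo : kolyvagin N W K) (hB : Kolyvagin1990_padicValNat_card_sha_le N W K) (hK : IsImaginaryQuadratic K)
    (hH : SatisfiesHeegnerHypothesis N K) {P : (W.baseChange K).toAffine.Point} (hP : IsHeegnerPoint N W K P)
    (hnt : ¬ IsOfFinAddOrder P) (hI : padicValNat 3 (AddSubgroup.zmultiples P).index ≤ 1)
    (Wd : WeierstrassCurve ℚ) [Wd.IsElliptic]
    (hWd : ∃ C : VariableChange ℚ, C • W.quadraticTwist ((NumberField.discr K : ℤ) : ℚ) = Wd)
    (hrD : Wd.analyticRank ≤ 1) (hr : W.analyticRank = 1)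
    {q : ℚ} (hq : shaAn W = (q : ℂ)) (hv : padicValRat 3 q = 2)
    (hSel : 3 ^ 3 ≤ Nat.card (W.selmerGroup (3 : ℤ))) : BSDp W 3 :=
  bsdp_three_of_kolyvaginIndexLeOne_of_le_card_selmer_of_irr_of_order 1 1 0 (-1523485213) (-25050274786307)
    (Supersingular.isGloballyMinimal_of_krausCriterion₃_factored 1 1 0 (-1523485213) (-25050274786307) [(2, 19), (3, 10), (5, 20), (59, 1), (257, 1)] (by decide +kernel)
      (by intro t ht; fin_cases ht <;> norm_num) (by decide +kernel))
    37 13 (by norm_num) (by norm_num) (by decide) (by decide) (by decide) (by decide) (by decide +kernel) (by decide +kernel)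
    (n₁ := 38) (n₂ := 21) (by decide +kernel) (by decide +kernel) (by decide) (by decide) (by decide) (by decide)
    hGZK hCT W hW hKo hB hK hH hP hnt hI Wd hWd hrD hr hq hv hSel

/-- **`BSD(E,3)` for `460023a1`** (`N = 460023 = 3·23·59·113`; `3 ∥ N`, non-split multiplicative at `3`, `E[3]` irreducible (class X11b); `#tors = 1`,
`∏c = 4` (`3 ∤ #tors·∏c`), `r_an = 1`, **`#Ш_an = 9`**, galrep none (no 3-code: `ρ̄_{E,3}` onto), generator `(1185, 40031)`; residue class of A2
state `45ab5fdd`, (3,'X11b') the SOLE open cell). HEEGNER INDEX (upper half): fields with `ord₃ m ≥ 2` before the certificate field: none. `D = -11`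
(11 prime; every prime of `N` split, `3 ∤ D`): **`m = 24`, `ord₃ m = 1`** (`ρ = ĥ(y_K)/ĥ(x) = 143.99…`; `L′(E,1) = 8.88560707…`,
`L(E^D,1) = 1.10974110…`, `ĥ(x) = 1.53432851…`) — engine 1 (j303974) = engine 2 (j304100; EQUAL `m = 24`, `ord₃ m = 1`, dev. ≤ 4.2e-15, checks true;
`3`-saturation witness prime [5, 3], `E(K)[3] = 0` witness prime [7, 'inert', 64]); twist `E^D` (stage C j304101): minimal model
`[0, -1, 1, -5690549, 5815331048]`, `N_{E^D} = 55662783`, root number `+1`, `L(E^D,1) = 1.10974110… ≠ 0` ⇒ `r_an(E^D) = 0`; `#tors = 1`, `∏c = 8`,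
`#Ш_an(E^D) = 1` — `3 ∤ #tors·#Ш_an(E^D)` (BSD-shape: the squeeze forces `Ш(E^D)[3] = 0`). DESCENT (lower half): engine C x11b `desc3lib` (j305968):
octic `A` disc `-97941548581422402393372267`, `S = [3, 23, 59, 113]`, `Cl(A) = [3, [3]]`, `bnfcertify(A,1) = 1`, `15` generators 3-saturated,
`dim H¹(ℚ,E[3];S) = 3`, **`dim Sel^(3)(E/ℚ) = 3`** (expected 3: MATCH), generator in `Sel`, mode `GRH(3sat)`, cert `certs/cert_460023a1.gp`
`6c6bdb92754e2f23…`; engine E x10b `desc3full_e2` (j305969): `Cl = [3, [3]]`, `Cl_S = [1, []]`, `15` generators, `bnfcertify = -2`, `dim H¹ = 3`,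
**`dim Sel^(3)(E/ℚ) = 3`**, mode `LOWERBOUND` — TWO independent implementations, descent grade **LL** (E = equality EXACT, L = three independent
EXACTLY verified Selmer elements = the unconditional LOWER bound `dim ≥ 3`; the kit uses only `3³ ≤ #Sel`) ⇒ `27 ≤ #Sel^(3)(E/ℚ)`, `Ш(E)[3] ≠ 0` —
the lower half. Witnesses mod `3` `(ℓ,#Ẽ(𝔽_ℓ))` = `(7,8)` (`a = 0`: `X² − aX + ℓ` root-free over `𝔽₃`), `(31,33)` (`ℓ ≡ 1`, `a = -1 ≡ 2 (mod 3)`,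
`9 ∤ #Ẽ`). `|Δ| = ∏` over `[(3, 7), (23, 2), (59, 4), (113, 1)]`. Kernel: minimality, onto, `3 ∣ #Ш` from `hSel`; displayed: `hGZK hCT hKo hB`,
Heegner datum (`hK hH hP hnt hI`), twist datum (`Wd hWd hrD`), `hr hq hv`, `hSel : 3³ ≤ #Sel^(3)(E/ℚ)`.
[cite: McCallumLMS1991, §1 Theorem (Kolyvagin), p. 296] [cite: SilvermanAEC2009, Thm. X.4.2(a) and Thm. X.4.14] [cite: Serre1972, §2.4 Prop. 15] [cite: Cremona2006, Table 1 (label 460023a1)] -/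
theorem bsdp_q460023a1_3 (hGZK : rank_eq_analyticRank_of_analyticRank_le_one)
    (hCT : exists_casselsTate_pairing (K := ℚ)) (W : WeierstrassCurve ℚ)
    (hW : W = ⟨0, -1, 1, -47029, -4352043⟩) {N : ℕ} [NeZero N] {K : Type} [Field K] [NumberField K]
    (hKo : kolyvagin N W K) (hB : Kolyvagin1990_padicValNat_card_sha_le N W K) (hK : IsImaginaryQuadratic K)
    (hH : SatisfiesHeegnerHypothesis N K) {P : (W.baseChange K).toAffine.Point} (hP : IsHeegnerPoint N W K P)
    (hnt : ¬ IsOfFinAddOrder P) (hI : padicValNat 3 (AddSubgroup.zmultiples P).index ≤ 1)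
    (Wd : WeierstrassCurve ℚ) [Wd.IsElliptic]
    (hWd : ∃ C : VariableChange ℚ, C • W.quadraticTwist ((NumberField.discr K : ℤ) : ℚ) = Wd)
    (hrD : Wd.analyticRank ≤ 1) (hr : W.analyticRank = 1)
    {q : ℚ} (hq : shaAn W = (q : ℂ)) (hv : padicValRat 3 q = 2)
    (hSel : 3 ^ 3 ≤ Nat.card (W.selmerGroup (3 : ℤ))) : BSDp W 3 :=
  bsdp_three_of_kolyvaginIndexLeOne_of_le_card_selmer_of_irr_of_order 0 (-1) 1 (-47029) (-4352043)
    (Supersingular.isGloballyMinimal_of_krausCriterion₃_factored 0 (-1) 1 (-47029) (-4352043) [(3, 7), (23, 2), (59, 4), (113, 1)] (by decide +kernel)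
      (by intro t ht; fin_cases ht <;> norm_num) (by decide +kernel))
    7 31 (by norm_num) (by norm_num) (by decide) (by decide) (by decide) (by decide) (by decide +kernel) (by decide +kernel)
    (n₁ := 8) (n₂ := 33) (by decide +kernel) (by decide +kernel) (by decide) (by decide) (by decide) (by decide)
    hGZK hCT W hW hKo hB hK hH hP hnt hI Wd hWd hrD hr hq hv hSel

/-- **`BSD(E,3)` for `463926a1`** (`N = 463926 = 2·3·167·463`; `3 ∥ N`, non-split multiplicative at `3`, `E[3]` irreducible (class X11b); `#tors = 2`,
`∏c = 8` (`3 ∤ #tors·∏c`), `r_an = 1`, **`#Ш_an = 9`**, galrep 2B (no 3-code: `ρ̄_{E,3}` onto), generator `(26, 419)`; residue class of A2 state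
`45ab5fdd`, (3,'X11b') the SOLE open cell). HEEGNER INDEX (upper half): fields with `ord₃ m ≥ 2` before the certificate field: none. `D = -23` (23
prime; every prime of `N` split, `3 ∤ D`): **`m = 24`, `ord₃ m = 1`** (`ρ = ĥ(y_K)/ĥ(x) = 143.99…`; `L′(E,1) = 8.91541189…`,
`L(E^D,1) = 1.41125615…`, `ĥ(x) = 1.11097277…`) — engine 1 (j303974) = engine 2 (j304100; EQUAL `m = 24`, `ord₃ m = 1`, dev. ≤ 7.1e-15, checks true;
`3`-saturation witness prime [7, 6], `E(K)[3] = 0` witness prime [5, 'inert', 32]); twist `E^D` (stage C j304101): minimal model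
`[1, 1, 0, 2777504, -357638144]`, `N_{E^D} = 245416854`, root number `+1`, `L(E^D,1) = 1.41125615… ≠ 0` ⇒ `r_an(E^D) = 0`; `#tors = 2`, `∏c = 16`,
`#Ш_an(E^D) = 4` — `3 ∤ #tors·#Ш_an(E^D)` (BSD-shape: the squeeze forces `Ш(E^D)[3] = 0`). DESCENT (lower half): engine C x11b `desc3lib` (j305968):
octic `A` disc `-1250715737030111376549552`, `S = [2, 3, 167, 463]`, `Cl(A) = [3, [3]]`, `bnfcertify(A,1) = 1`, `16` generators 3-saturated,
`dim H¹(ℚ,E[3];S) = 4`, **`dim Sel^(3)(E/ℚ) = 3`** (expected 3: MATCH), generator in `Sel`, mode `GRH(3sat)`, cert `certs/cert_463926a1.gp`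
`d0ddca7d9f62c464…`; engine E x10b `desc3full_e2` (j305969): `Cl = [3, [3]]`, `Cl_S = [1, []]`, `16` generators, `bnfcertify = -2`, `dim H¹ = 4`,
**`dim Sel^(3)(E/ℚ) = 3`**, mode `LOWERBOUND` — TWO independent implementations, descent grade **LL** (E = equality EXACT, L = three independent
EXACTLY verified Selmer elements = the unconditional LOWER bound `dim ≥ 3`; the kit uses only `3³ ≤ #Sel`) ⇒ `27 ≤ #Sel^(3)(E/ℚ)`, `Ш(E)[3] ≠ 0` —
the lower half. Witnesses mod `3` `(ℓ,#Ẽ(𝔽_ℓ))` = `(5,4)` (`a = 2`: `X² − aX + ℓ` root-free over `𝔽₃`), `(7,6)` (`ℓ ≡ 1`, `a = 2 ≡ 2 (mod 3)`,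
`9 ∤ #Ẽ`). `|Δ| = ∏` over `[(2, 10), (3, 6), (167, 2), (463, 1)]`. Kernel: minimality, onto, `3 ∣ #Ш` from `hSel`; displayed: `hGZK hCT hKo hB`,
Heegner datum (`hK hH hP hnt hI`), twist datum (`Wd hWd hrD`), `hr hq hv`, `hSel : 3³ ≤ #Sel^(3)(E/ℚ)`.
[cite: McCallumLMS1991, §1 Theorem (Kolyvagin), p. 296] [cite: SilvermanAEC2009, Thm. X.4.2(a) and Thm. X.4.14] [cite: Serre1972, §2.4 Prop. 15] [cite: Cremona2006, Table 1 (label 463926a1)] -/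
theorem bsdp_q463926a1_3 (hGZK : rank_eq_analyticRank_of_analyticRank_le_one)
    (hCT : exists_casselsTate_pairing (K := ℚ)) (W : WeierstrassCurve ℚ)
    (hW : W = ⟨1, 1, 0, 5251, 31677⟩) {N : ℕ} [NeZero N] {K : Type} [Field K] [NumberField K]
    (hKo : kolyvagin N W K) (hB : Kolyvagin1990_padicValNat_card_sha_le N W K) (hK : IsImaginaryQuadratic K)
    (hH : SatisfiesHeegnerHypothesis N K) {P : (W.baseChange K).toAffine.Point} (hP : IsHeegnerPoint N W K P)
    (hnt : ¬ IsOfFinAddOrder P) (hI : padicValNat 3 (AddSubgroup.zmultiples P).index ≤ 1)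
    (Wd : WeierstrassCurve ℚ) [Wd.IsElliptic]
    (hWd : ∃ C : VariableChange ℚ, C • W.quadraticTwist ((NumberField.discr K : ℤ) : ℚ) = Wd)
    (hrD : Wd.analyticRank ≤ 1) (hr : W.analyticRank = 1)
    {q : ℚ} (hq : shaAn W = (q : ℂ)) (hv : padicValRat 3 q = 2)
    (hSel : 3 ^ 3 ≤ Nat.card (W.selmerGroup (3 : ℤ))) : BSDp W 3 :=
  bsdp_three_of_kolyvaginIndexLeOne_of_le_card_selmer_of_irr_of_order 1 1 0 5251 31677
    (Supersingular.isGloballyMinimal_of_krausCriterion₃_factored 1 1 0 5251 31677 [(2, 10), (3, 6), (167, 2), (463, 1)] (by decide +kernel)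
      (by intro t ht; fin_cases ht <;> norm_num) (by decide +kernel))
    5 7 (by norm_num) (by norm_num) (by decide) (by decide) (by decide) (by decide) (by decide +kernel) (by decide +kernel)
    (n₁ := 4) (n₂ := 6) (by decide +kernel) (by decide +kernel) (by decide) (by decide) (by decide) (by decide)
    hGZK hCT W hW hKo hB hK hH hP hnt hI Wd hWd hrD hr hq hv hSel

/-- **`BSD(E,3)` for `466350e1`** (`N = 466350 = 2·3·5²·3109`; `3 ∥ N`, non-split multiplicative at `3`, `E[3]` irreducible (class X11b); `#tors = 1`,
`∏c = 8` (`3 ∤ #tors·∏c`), `r_an = 1`, **`#Ш_an = 9`**, galrep none (no 3-code: `ρ̄_{E,3}` onto), generator `(54370/9, 9918445/27)`; residue class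
of A2 state `45ab5fdd`, (3,'X11b') the SOLE open cell). HEEGNER INDEX (upper half): fields with `ord₃ m ≥ 2` before the certificate field: none.
`D = -119` (119 = 7·17; every prime of `N` split, `3 ∤ D`): **`m = 48`, `ord₃ m = 1`** (`ρ = ĥ(y_K)/ĥ(x) = 576.00…`; `L′(E,1) = 7.03082523…`,
`L(E^D,1) = 0.24492852…`, `ĥ(x) = 2.37491221…`) — engine 1 (j303974) = engine 2 (j304100; EQUAL `m = 48`, `ord₃ m = 1`, dev. ≤ 4.9e-15, checks true;
`3`-saturation witness prime [11, 15], `E(K)[3] = 0` witness prime [13, 'inert', 187]); twist `E^D` (stage C j304101): minimal model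
`[1, 1, 0, -160756033400, 24870056988552000]`, `N_{E^D} = 6603982350`, root number `+1`, `L(E^D,1) = 0.24492852… ≠ 0` ⇒ `r_an(E^D) = 0`;
`#tors = 1`, `∏c = 16`, `#Ш_an(E^D) = 1` — `3 ∤ #tors·#Ш_an(E^D)` (BSD-shape: the squeeze forces `Ш(E^D)[3] = 0`). DESCENT (lower half): engine C
x11b `desc3lib` (j305968): octic `A` disc `-4137678081287475666750000`, `S = [2, 3, 5, 7, 11, 3109]`, `Cl(A) = [36, [6, 6]]`, `bnfcertify(A,1) = 1`,
`20` generators 3-saturated, `dim H¹(ℚ,E[3];S) = 3`, **`dim Sel^(3)(E/ℚ) = 3`** (expected 3: MATCH), generator in `Sel`, mode `GRH(3sat)`, cert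
`certs/cert_466350e1.gp` `78f22aad70f45b6d…`; engine E x10b `desc3full_e2` (j305969): `Cl = [36, [6, 6]]`, `Cl_S = [1, []]`, `20` generators,
`bnfcertify = -2`, `dim H¹ = 3`, **`dim Sel^(3)(E/ℚ) = 3`**, mode `LOWERBOUND` — TWO independent implementations, descent grade **LL** (E = equality
EXACT, L = three independent EXACTLY verified Selmer elements = the unconditional LOWER bound `dim ≥ 3`; the kit uses only `3³ ≤ #Sel`) ⇒
`27 ≤ #Sel^(3)(E/ℚ)`, `Ш(E)[3] ≠ 0` — the lower half. Witnesses mod `3` `(ℓ,#Ẽ(𝔽_ℓ))` = `(13,11)` (`a = 3`: `X² − aX + ℓ` root-free over `𝔽₃`),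
`(31,24)` (`ℓ ≡ 1`, `a = 8 ≡ 2 (mod 3)`, `9 ∤ #Ẽ`). `|Δ| = ∏` over `[(2, 16), (3, 1), (5, 17), (3109, 1)]`. Kernel: minimality, onto, `3 ∣ #Ш` from
`hSel`; displayed: `hGZK hCT hKo hB`, Heegner datum (`hK hH hP hnt hI`), twist datum (`Wd hWd hrD`), `hr hq hv`, `hSel : 3³ ≤ #Sel^(3)(E/ℚ)`.
[cite: McCallumLMS1991, §1 Theorem (Kolyvagin), p. 296] [cite: SilvermanAEC2009, Thm. X.4.2(a) and Thm. X.4.14] [cite: Serre1972, §2.4 Prop. 15] [cite: Cremona2006, Table 1 (label 466350e1)] -/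
theorem bsdp_q466350e1_3 (hGZK : rank_eq_analyticRank_of_analyticRank_le_one)
    (hCT : exists_casselsTate_pairing (K := ℚ)) (W : WeierstrassCurve ℚ)
    (hW : W = ⟨1, 1, 0, -11352025, -14763054875⟩) {N : ℕ} [NeZero N] {K : Type} [Field K] [NumberField K]
    (hKo : kolyvagin N W K) (hB : Kolyvagin1990_padicValNat_card_sha_le N W K) (hK : IsImaginaryQuadratic K)
    (hH : SatisfiesHeegnerHypothesis N K) {P : (W.baseChange K).toAffine.Point} (hP : IsHeegnerPoint N W K P)
    (hnt : ¬ IsOfFinAddOrder P) (hI : padicValNat 3 (AddSubgroup.zmultiples P).index ≤ 1)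
    (Wd : WeierstrassCurve ℚ) [Wd.IsElliptic]
    (hWd : ∃ C : VariableChange ℚ, C • W.quadraticTwist ((NumberField.discr K : ℤ) : ℚ) = Wd)
    (hrD : Wd.analyticRank ≤ 1) (hr : W.analyticRank = 1)
    {q : ℚ} (hq : shaAn W = (q : ℂ)) (hv : padicValRat 3 q = 2)
    (hSel : 3 ^ 3 ≤ Nat.card (W.selmerGroup (3 : ℤ))) : BSDp W 3 :=
  bsdp_three_of_kolyvaginIndexLeOne_of_le_card_selmer_of_irr_of_order 1 1 0 (-11352025) (-14763054875)
    (Supersingular.isGloballyMinimal_of_krausCriterion₃_factored 1 1 0 (-11352025) (-14763054875) [(2, 16), (3, 1), (5, 17), (3109, 1)] (by decide +kernel)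
      (by intro t ht; fin_cases ht <;> norm_num) (by decide +kernel))
    13 31 (by norm_num) (by norm_num) (by decide) (by decide) (by decide) (by decide) (by decide +kernel) (by decide +kernel)
    (n₁ := 11) (n₂ := 24) (by decide +kernel) (by decide +kernel) (by decide) (by decide) (by decide) (by decide)
    hGZK hCT W hW hKo hB hK hH hP hnt hI Wd hWd hrD hr hq hv hSel

/-- **`BSD(E,3)` for `468438b1`** (`N = 468438 = 2·3·101·773`; `3 ∥ N`, non-split multiplicative at `3`, `E[3]` irreducible (class X11b); `#tors = 2`,
`∏c = 4` (`3 ∤ #tors·∏c`), `r_an = 1`, **`#Ш_an = 9`**, galrep 2B (no 3-code: `ρ̄_{E,3}` onto), generator `(-389, 842)`; residue class of A2 state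
`45ab5fdd`, (3,'X11b') the SOLE open cell). HEEGNER INDEX (upper half): fields with `ord₃ m ≥ 2` before the certificate field: none. `D = -47` (47
prime; every prime of `N` split, `3 ∤ D`): **`m = 24`, `ord₃ m = 1`** (`ρ = ĥ(y_K)/ĥ(x) = 144.00…`; `L′(E,1) = 9.06702862…`,
`L(E^D,1) = 0.74604416…`, `ĥ(x) = 5.67853685…`) — engine 1 (j303974) = engine 2 (j304100; EQUAL `m = 24`, `ord₃ m = 1`, dev. ≤ 2.2e-14, checks true;
`3`-saturation witness prime [89, 84], `E(K)[3] = 0` witness prime [5, 'inert', 32]); twist `E^D` (stage C j304101): minimal model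
`[1, 1, 0, -1161745176, 15081617468736]`, `N_{E^D} = 1034779542`, root number `+1`, `L(E^D,1) = 0.74604416… ≠ 0` ⇒ `r_an(E^D) = 0`; `#tors = 2`,
`∏c = 16`, `#Ш_an(E^D) = 4` — `3 ∤ #tors·#Ш_an(E^D)` (BSD-shape: the squeeze forces `Ш(E^D)[3] = 0`). DESCENT (lower half): engine C x11b `desc3lib`
(j305968): octic `A` disc `-105307003557588964782182832`, `S = [2, 3, 101, 773]`, `Cl(A) = [9, [3, 3]]`, `bnfcertify(A,1) = 1`, `15` generators
3-saturated, `dim H¹(ℚ,E[3];S) = 3`, **`dim Sel^(3)(E/ℚ) = 3`** (expected 3: MATCH), generator in `Sel`, mode `GRH(3sat)`, cert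
`certs/cert_468438b1.gp` `9e57733acb964f42…`; engine E x10b `desc3full_e2` (j305969): `Cl = [9, [3, 3]]`, `Cl_S = [1, []]`, `15` generators,
`bnfcertify = -2`, `dim H¹ = 3`, **`dim Sel^(3)(E/ℚ) = 3`**, mode `LOWERBOUND` — TWO independent implementations, descent grade **LL** (E = equality
EXACT, L = three independent EXACTLY verified Selmer elements = the unconditional LOWER bound `dim ≥ 3`; the kit uses only `3³ ≤ #Sel`) ⇒
`27 ≤ #Sel^(3)(E/ℚ)`, `Ш(E)[3] ≠ 0` — the lower half. Witnesses mod `3` `(ℓ,#Ẽ(𝔽_ℓ))` = `(5,4)` (`a = 2`: `X² − aX + ℓ` root-free over `𝔽₃`),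
`(43,48)` (`ℓ ≡ 1`, `a = -4 ≡ 2 (mod 3)`, `9 ∤ #Ẽ`). `|Δ| = ∏` over `[(2, 38), (3, 2), (101, 1), (773, 1)]`. Kernel: minimality, onto, `3 ∣ #Ш` from
`hSel`; displayed: `hGZK hCT hKo hB`, Heegner datum (`hK hH hP hnt hI`), twist datum (`Wd hWd hrD`), `hr hq hv`, `hSel : 3³ ≤ #Sel^(3)(E/ℚ)`.
[cite: McCallumLMS1991, §1 Theorem (Kolyvagin), p. 296] [cite: SilvermanAEC2009, Thm. X.4.2(a) and Thm. X.4.14] [cite: Serre1972, §2.4 Prop. 15] [cite: Cremona2006, Table 1 (label 468438b1)] -/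
theorem bsdp_q468438b1_3 (hGZK : rank_eq_analyticRank_of_analyticRank_le_one)
    (hCT : exists_casselsTate_pairing (K := ℚ)) (W : WeierstrassCurve ℚ)
    (hW : W = ⟨1, 1, 0, -525914, -145486572⟩) {N : ℕ} [NeZero N] {K : Type} [Field K] [NumberField K]
    (hKo : kolyvagin N W K) (hB : Kolyvagin1990_padicValNat_card_sha_le N W K) (hK : IsImaginaryQuadratic K)
    (hH : SatisfiesHeegnerHypothesis N K) {P : (W.baseChange K).toAffine.Point} (hP : IsHeegnerPoint N W K P)
    (hnt : ¬ IsOfFinAddOrder P) (hI : padicValNat 3 (AddSubgroup.zmultiples P).index ≤ 1)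
    (Wd : WeierstrassCurve ℚ) [Wd.IsElliptic]
    (hWd : ∃ C : VariableChange ℚ, C • W.quadraticTwist ((NumberField.discr K : ℤ) : ℚ) = Wd)
    (hrD : Wd.analyticRank ≤ 1) (hr : W.analyticRank = 1)
    {q : ℚ} (hq : shaAn W = (q : ℂ)) (hv : padicValRat 3 q = 2)
    (hSel : 3 ^ 3 ≤ Nat.card (W.selmerGroup (3 : ℤ))) : BSDp W 3 :=
  bsdp_three_of_kolyvaginIndexLeOne_of_le_card_selmer_of_irr_of_order 1 1 0 (-525914) (-145486572)
    (Supersingular.isGloballyMinimal_of_krausCriterion₃_factored 1 1 0 (-525914) (-145486572) [(2, 38), (3, 2), (101, 1), (773, 1)] (by decide +kernel)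
      (by intro t ht; fin_cases ht <;> norm_num) (by decide +kernel))
    5 43 (by norm_num) (by norm_num) (by decide) (by decide) (by decide) (by decide) (by decide +kernel) (by decide +kernel)
    (n₁ := 4) (n₂ := 48) (by decide +kernel) (by decide +kernel) (by decide) (by decide) (by decide) (by decide)
    hGZK hCT W hW hKo hB hK hH hP hnt hI Wd hWd hrD hr hq hv hSel

/-- **`BSD(E,3)` for `468519c1`** (`N = 468519 = 3·59·2647`; `3 ∥ N`, non-split multiplicative at `3`, `E[3]` irreducible (class X11b); `#tors = 2`,
`∏c = 2` (`3 ∤ #tors·∏c`), `r_an = 1`, **`#Ш_an = 9`**, galrep 2B (no 3-code: `ρ̄_{E,3}` onto), generator `(-13292/49, 33214/343)`; residue class of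
A2 state `45ab5fdd`, (3,'X11b') the SOLE open cell). HEEGNER INDEX (upper half): fields with `ord₃ m ≥ 2` before the certificate field: none.
`D = -23` (23 prime; every prime of `N` split, `3 ∤ D`): **`m = 6`, `ord₃ m = 1`** (`ρ = ĥ(y_K)/ĥ(x) = 8.99…`; `L′(E,1) = 7.78142030…`,
`L(E^D,1) = 0.24288265…`, `ĥ(x) = 7.83195833…`) — engine 1 (j303974) = engine 2 (j304100; EQUAL `m = 6`, `ord₃ m = 1`, dev. ≤ 5.1e-15, checks true;
`3`-saturation witness prime [5, 6], `E(K)[3] = 0` witness prime [7, 'inert', 64]); twist `E^D` (stage C j304101): minimal model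
`[1, 1, 0, -115652900, 478647072819]`, `N_{E^D} = 247846551`, root number `+1`, `L(E^D,1) = 0.24288265… ≠ 0` ⇒ `r_an(E^D) = 0`; `#tors = 2`,
`∏c = 8`, `#Ш_an(E^D) = 1` — `3 ∤ #tors·#Ш_an(E^D)` (BSD-shape: the squeeze forces `Ш(E^D)[3] = 0`). DESCENT (lower half): engine C x11b `desc3lib`
(j305968): octic `A` disc `-105379859132562810395754027`, `S = [3, 59, 2647]`, `Cl(A) = [3, [3]]`, `bnfcertify(A,1) = 1`, `13` generators
3-saturated, `dim H¹(ℚ,E[3];S) = 3`, **`dim Sel^(3)(E/ℚ) = 3`** (expected 3: MATCH), generator in `Sel`, mode `GRH(3sat)`, cert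
`certs/cert_468519c1.gp` `a0164f0485cb05f4…`; engine E x10b `desc3full_e2` (j305969): `Cl = [3, [3]]`, `Cl_S = [1, []]`, `13` generators,
`bnfcertify = -2`, `dim H¹ = 3`, **`dim Sel^(3)(E/ℚ) = 3`**, mode `LOWERBOUND` — TWO independent implementations, descent grade **LL** (E = equality
EXACT, L = three independent EXACTLY verified Selmer elements = the unconditional LOWER bound `dim ≥ 3`; the kit uses only `3³ ≤ #Sel`) ⇒
`27 ≤ #Sel^(3)(E/ℚ)`, `Ш(E)[3] ≠ 0` — the lower half. Witnesses mod `3` `(ℓ,#Ẽ(𝔽_ℓ))` = `(7,8)` (`a = 0`: `X² − aX + ℓ` root-free over `𝔽₃`),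
`(31,30)` (`ℓ ≡ 1`, `a = 2 ≡ 2 (mod 3)`, `9 ∤ #Ẽ`). `|Δ| = ∏` over `[(3, 11), (59, 1), (2647, 2)]`. Kernel: minimality, onto, `3 ∣ #Ш` from `hSel`;
displayed: `hGZK hCT hKo hB`, Heegner datum (`hK hH hP hnt hI`), twist datum (`Wd hWd hrD`), `hr hq hv`, `hSel : 3³ ≤ #Sel^(3)(E/ℚ)`.
[cite: McCallumLMS1991, §1 Theorem (Kolyvagin), p. 296] [cite: SilvermanAEC2009, Thm. X.4.2(a) and Thm. X.4.14] [cite: Serre1972, §2.4 Prop. 15] [cite: Cremona2006, Table 1 (label 468519c1)] -/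
theorem bsdp_q468519c1_3 (hGZK : rank_eq_analyticRank_of_analyticRank_le_one)
    (hCT : exists_casselsTate_pairing (K := ℚ)) (W : WeierstrassCurve ℚ)
    (hW : W = ⟨1, 1, 0, -218625, -39434832⟩) {N : ℕ} [NeZero N] {K : Type} [Field K] [NumberField K]
    (hKo : kolyvagin N W K) (hB : Kolyvagin1990_padicValNat_card_sha_le N W K) (hK : IsImaginaryQuadratic K)
    (hH : SatisfiesHeegnerHypothesis N K) {P : (W.baseChange K).toAffine.Point} (hP : IsHeegnerPoint N W K P)
    (hnt : ¬ IsOfFinAddOrder P) (hI : padicValNat 3 (AddSubgroup.zmultiples P).index ≤ 1)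
    (Wd : WeierstrassCurve ℚ) [Wd.IsElliptic]
    (hWd : ∃ C : VariableChange ℚ, C • W.quadraticTwist ((NumberField.discr K : ℤ) : ℚ) = Wd)
    (hrD : Wd.analyticRank ≤ 1) (hr : W.analyticRank = 1)
    {q : ℚ} (hq : shaAn W = (q : ℂ)) (hv : padicValRat 3 q = 2)
    (hSel : 3 ^ 3 ≤ Nat.card (W.selmerGroup (3 : ℤ))) : BSDp W 3 :=
  bsdp_three_of_kolyvaginIndexLeOne_of_le_card_selmer_of_irr_of_order 1 1 0 (-218625) (-39434832)
    (Supersingular.isGloballyMinimal_of_krausCriterion₃_factored 1 1 0 (-218625) (-39434832) [(3, 11), (59, 1), (2647, 2)] (by decide +kernel)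
      (by intro t ht; fin_cases ht <;> norm_num) (by decide +kernel))
    7 31 (by norm_num) (by norm_num) (by decide) (by decide) (by decide) (by decide) (by decide +kernel) (by decide +kernel)
    (n₁ := 8) (n₂ := 30) (by decide +kernel) (by decide +kernel) (by decide) (by decide) (by decide) (by decide)
    hGZK hCT W hW hKo hB hK hH hP hnt hI Wd hWd hrD hr hq hv hSel

/-- **`BSD(E,3)` for `471417f1`** (`N = 471417 = 3·31·37·137`; `3 ∥ N`, non-split multiplicative at `3`, `E[3]` irreducible (class X11b); `#tors = 1`,
`∏c = 2` (`3 ∤ #tors·∏c`), `r_an = 1`, **`#Ш_an = 9`**, galrep none (no 3-code: `ρ̄_{E,3}` onto), generator `(1505/16, 59017/64)`; residue class of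
A2 state `45ab5fdd`, (3,'X11b') the SOLE open cell). HEEGNER INDEX (upper half): fields with `ord₃ m ≥ 2` before the certificate field: none.
`D = -11` (11 prime; every prime of `N` split, `3 ∤ D`): **`m = 12`, `ord₃ m = 1`** (`ρ = ĥ(y_K)/ĥ(x) = 36.00…`; `L′(E,1) = 21.34720115…`,
`L(E^D,1) = 0.67020360…`, `ĥ(x) = 3.23807354…`) — engine 1 (j303974) = engine 2 (j304100; EQUAL `m = 12`, `ord₃ m = 1`, dev. ≤ 2.3e-15, checks true;
`3`-saturation witness prime [5, 3], `E(K)[3] = 0` witness prime [19, 'inert', 400]); twist `E^D` (stage C j304101): minimal model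
`[0, -1, 1, 194286, 163192358]`, `N_{E^D} = 57041457`, root number `+1`, `L(E^D,1) = 0.67020360… ≠ 0` ⇒ `r_an(E^D) = 0`; `#tors = 1`, `∏c = 4`,
`#Ш_an(E^D) = 1` — `3 ∤ #tors·#Ш_an(E^D)` (BSD-shape: the squeeze forces `Ш(E^D)[3] = 0`). DESCENT (lower half): engine C x11b `desc3lib` (j305968):
octic `A` disc `-108011436530856410505114027`, `S = [3, 31, 37, 137]`, `Cl(A) = [3, [3]]`, `bnfcertify(A,1) = 1`, `15` generators 3-saturated,
`dim H¹(ℚ,E[3];S) = 4`, **`dim Sel^(3)(E/ℚ) = 3`** (expected 3: MATCH), generator in `Sel`, mode `GRH(3sat)`, cert `certs/cert_471417f1.gp`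
`9b5dc1f9ddb8e746…`; engine E x10b `desc3full_e2` (j305969): `Cl = [3, [3]]`, `Cl_S = [1, []]`, `15` generators, `bnfcertify = -2`, `dim H¹ = 4`,
**`dim Sel^(3)(E/ℚ) = 3`**, mode `LOWERBOUND` — TWO independent implementations, descent grade **LL** (E = equality EXACT, L = three independent
EXACTLY verified Selmer elements = the unconditional LOWER bound `dim ≥ 3`; the kit uses only `3³ ≤ #Sel`) ⇒ `27 ≤ #Sel^(3)(E/ℚ)`, `Ш(E)[3] ≠ 0` —
the lower half. Witnesses mod `3` `(ℓ,#Ẽ(𝔽_ℓ))` = `(11,10)` (`a = 2`: `X² − aX + ℓ` root-free over `𝔽₃`), `(97,111)` (`ℓ ≡ 1`,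
`a = -13 ≡ 2 (mod 3)`, `9 ∤ #Ẽ`). `|Δ| = ∏` over `[(3, 16), (31, 1), (37, 1), (137, 1)]`. Kernel: minimality, onto, `3 ∣ #Ш` from `hSel`; displayed:
`hGZK hCT hKo hB`, Heegner datum (`hK hH hP hnt hI`), twist datum (`Wd hWd hrD`), `hr hq hv`, `hSel : 3³ ≤ #Sel^(3)(E/ℚ)`.
[cite: McCallumLMS1991, §1 Theorem (Kolyvagin), p. 296] [cite: SilvermanAEC2009, Thm. X.4.2(a) and Thm. X.4.14] [cite: Serre1972, §2.4 Prop. 15] [cite: Cremona2006, Table 1 (label 471417f1)] -/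
theorem bsdp_q471417f1_3 (hGZK : rank_eq_analyticRank_of_analyticRank_le_one)
    (hCT : exists_casselsTate_pairing (K := ℚ)) (W : WeierstrassCurve ℚ)
    (hW : W = ⟨0, -1, 1, 1606, -123193⟩) {N : ℕ} [NeZero N] {K : Type} [Field K] [NumberField K]
    (hKo : kolyvagin N W K) (hB : Kolyvagin1990_padicValNat_card_sha_le N W K) (hK : IsImaginaryQuadratic K)
    (hH : SatisfiesHeegnerHypothesis N K) {P : (W.baseChange K).toAffine.Point} (hP : IsHeegnerPoint N W K P)
    (hnt : ¬ IsOfFinAddOrder P) (hI : padicValNat 3 (AddSubgroup.zmultiples P).index ≤ 1)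
    (Wd : WeierstrassCurve ℚ) [Wd.IsElliptic]
    (hWd : ∃ C : VariableChange ℚ, C • W.quadraticTwist ((NumberField.discr K : ℤ) : ℚ) = Wd)
    (hrD : Wd.analyticRank ≤ 1) (hr : W.analyticRank = 1)
    {q : ℚ} (hq : shaAn W = (q : ℂ)) (hv : padicValRat 3 q = 2)
    (hSel : 3 ^ 3 ≤ Nat.card (W.selmerGroup (3 : ℤ))) : BSDp W 3 :=
  bsdp_three_of_kolyvaginIndexLeOne_of_le_card_selmer_of_irr_of_order 0 (-1) 1 1606 (-123193)
    (Supersingular.isGloballyMinimal_of_krausCriterion₃_factored 0 (-1) 1 1606 (-123193) [(3, 16), (31, 1), (37, 1), (137, 1)] (by decide +kernel)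
      (by intro t ht; fin_cases ht <;> norm_num) (by decide +kernel))
    11 97 (by norm_num) (by norm_num) (by decide) (by decide) (by decide) (by decide) (by decide +kernel) (by decide +kernel)
    (n₁ := 10) (n₂ := 111) (by decide +kernel) (by decide +kernel) (by decide) (by decide) (by decide) (by decide)
    hGZK hCT W hW hKo hB hK hH hP hnt hI Wd hWd hrD hr hq hv hSel

end Summit.BirchSwinnertonDyer.Rank1Residual.X11b

end
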